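import Summits.Schanuel.Schanuel.Theorems.RootDecomp1KM30LevelSet01

/-!
# RootDecomp1KM30LevelSet (part 02 of 02) — CENSUS PROVENANCE for lens-1 g72 NODE 32 REVISED «the EXACT level set of M30» (STATUS L3252; ERRATUM / K v2 L3258; the ×0 BONUS of CLAIM NODE 32 L3239 as priced by crit-1 (g13) PRICE NODE 32 L3240 (2) «WELCOME AS A ×0 PORT if sorry-free and stated against the TREE's predicates»; AUDIT / PORT GO L3255, AMENDED L3257 (3) «CONDITIONAL on ONE PROSE FIX» — met by K v2; main heads NOT ported — NO-GO L3240 (1): they are the census certificate `RootDecomp1KGenusZeroNormShape` p851056, imported here by name)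

(census-1 g27 ×0 record port, `--supports stmt-Schanuel-33364`, no credit to anyone.  SOURCE: the lens's kernel HOME/decomp-schanuel-lens-1/g72/lean/M30LevelSet.lean v2 sha256 6cd5aba0debc584d… (533 l; code byte-identical to v1 6c02827d930adf44…, two docstring sentences corrected per the census instrument ls3 / crit e32-2: the only level below 4 is N = 1, x = s₁ = 1; ONE import `…RootDecomp1KGenusZeroNormShape`; ONE namespace `…Theorems.RootDecomp1KM30LevelSet`; ONE section `M30Exact`; lens farm rc 0 · 0 sorries; critic AUDIT L3255: byte identity, farm rc 0 · 26 dupNamespace, `--axioms` standard on m30_no_level_point / levelSet_m30_subset / levelFinite_m30_elementary / m30_core / descent, probe rc 0 / CTRL rc 1, closure-walker: Ridout-free and Literature-free; census re-check of a byte copy rc 0 · 0 errors · 0 sorries) split by the census at the §2/§3 boundary for the 400-line cap: part 01 = K l.1–235 (module docstring, §1 the order ℤ[ω] as integer pairs — `mulW` / `mulWb` / `nrm` / `descent` / `mulW_iter5` / `lineW_inv` / `lineW_snd` / `mulWb_iter5` / `lineWb_inv` / `nrm_eq_one` —, §2 the residues mod 32 `res_a`…`res_e`) + the section / namespace closers;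 part 02 = K l.237–533 (§3 `m30_core`; §4 `psNumer_two_mod32`, `m30_no_level_point`, `levelSet_m30_subset`, `levelFinite_m30_elementary`) behind `import …RootDecomp1KM30LevelSet01` and the re-opened header (noncomputable section / namespace / opens / `section M30Exact` verbatim = K l.33–47).  Bodies BYTE-VERBATIM; nothing renamed, nothing privatised, no `set_option`; the ONLY port-side changes are ten synthesised one-line docstrings in part 01 on the lens's undocumented `@[simp]` projections `mulW_fst` / `mulW_snd` / `mulWb_fst` / `mulWb_snd`, on `mulWb_mulW` and on `res_a`…`res_e` (gate lint.docstring), and in part 02 the lens's `theorem levelFinite_m30_elementary : LevelFinite (boxP m30Box)` turned into an `example` with a PORT NOTE (gate dedup.landed: it restates the census certificate's `levelFinite_m30`, the decision of record).  Census instrument cross-check (LEVELSET-G0-v1 «ls3», INSTRUMENT NOTE 63 L3254; crit L3257 (2) confirmed N ≤ 3): LS(M30) ∩ [0,10] = {1} by two independent exact methods — with `m30_no_level_point` (every N ≥ 4) the EXACT level set of M30 is {1}.  Rung 0; nothing here proves Schanuel, 33364, 33363, 31077, 31987, `ThinFibre 2`, W4, DJ 2 or a binder; the decision OF RECORD for row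 74 stays `…GenusZeroNormShape.thinFibreAt_m30` / `levelFinite_m30`.)
-/

/-!
# RootDecomp1KM30LevelSet02 — lens 1, generation 72: the EXACT level set of `M30` (elementary, effective) — continuation (§3 the arithmetic core `m30_core`; §4 `m30_no_level_point` (NO rational point at any depth `N ≥ 4`), `levelSet_m30_subset`, `levelFinite_m30_elementary`); module docstring of record in part 01.
-/

noncomputable section

namespace Summit.Schanuel.Schanuel.Theorems.RootDecomp1KM30LevelSet

open Polynomial LiouvilleNumber
open scoped Nat
open Summit.Schanuel.Schanuel.Theorems.RootDecomp1KTwoBaseCell (psNumer)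
open Summit.Schanuel.Schanuel.Theorems.RootDecomp1KDegreeLadder (bev psNumer_succ')
open Summit.Schanuel.Schanuel.Theorems.RootDecomp1KSectorSubspace (boxP m30Box bev_m30)
open Summit.Schanuel.Schanuel.Theorems.RootDecomp1KLevelFinite (LevelSet LevelFinite le_of_pow_dvd_pow_mul_odd
  two_adic_decomp)
open Summit.Schanuel.Schanuel.Theorems.RootDecomp1KParamThueMahler (partialSum_two_eq_ratCast)
open Summit.Schanuel.Schanuel.Theorems.RootDecomp1KGenusZeroNormShape (m30_normShape)

section M30Exact

/-! ### §3  the arithmetic core: `2^L · W(a₁,b) = 4p (a₁² + 7 b²)²` has no solutions -/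

/-- **Core.**  For `L ≥ 24`, `4 ∣ L`, `p ≡ 1 (mod 32)` and coprime `(a₁, b)`, `b ≠ 0`, the equation
`2^L · W(a₁,b) = 4 p (a₁² + 7 b²)²`, `W = 3a₁⁴ − 4a₁³b + 94a₁²b² + 148a₁b³ + 159b⁴` (the numerator form of the tree's
parametrisation `m30_normShape`, up to `b ↦ −b`), is impossible.  Elementary: 2-adic bookkeeping, the split prime
`2 = ω ω̄` in the class-number-one order `ℤ[(1+√-7)/2]` with unit group `{±1}`, and fourth powers of odd numbers mod `32`. -/
theorem m30_core (L : ℕ) (hL : 24 ≤ L) (hL4 : 4 ∣ L) (p : ℤ) (hp : (32:ℤ) ∣ p - 1)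
    (a₁ b : ℤ) (hb : b ≠ 0) (hab : IsCoprime a₁ b)
    (hW : 2 ^ L * (3 * a₁ ^ 4 - 4 * a₁ ^ 3 * b + 94 * a₁ ^ 2 * b ^ 2 + 148 * a₁ * b ^ 3 + 159 * b ^ 4)
      = 4 * p * (a₁ ^ 2 + 7 * b ^ 2) ^ 2) : False := by
  have hp2 : ¬ (2:ℤ) ∣ p := by omega
  set K := a₁ ^ 2 + 7 * b ^ 2 with hKdef
  set W := 3 * a₁ ^ 4 - 4 * a₁ ^ 3 * b + 94 * a₁ ^ 2 * b ^ 2 + 148 * a₁ * b ^ 3 + 159 * b ^ 4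
    with hWdef
  -- (E1) `K` is even (else `2^L ∣ 4·odd`)
  have hKeven : (2:ℤ) ∣ K := by
    by_contra hKodd
    have hodd : ¬ (2:ℤ) ∣ p * K ^ 2 := fun h2 =>
      (Int.prime_two.dvd_mul.mp h2).elim hp2 (fun h3 => hKodd (Int.prime_two.dvd_of_dvd_pow h3))
    have hdvd : (2:ℤ) ^ L ∣ 2 ^ 2 * (p * K ^ 2) := ⟨W, by linear_combination -hW⟩
    have := le_of_pow_dvd_pow_mul_odd hodd hdvd
    omega
  -- (E2) `b` is odd, (E3) `a₁` is odd
  have hb2 : ¬ (2:ℤ) ∣ b := fun h2 => by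
    have h3 : (2:ℤ) ∣ b ^ 2 := dvd_pow h2 two_ne_zero
    have h4 : (2:ℤ) ∣ a₁ ^ 2 := by rw [hKdef] at hKeven; omega
    have := hab.isUnit_of_dvd' (Int.prime_two.dvd_of_dvd_pow h4) h2
    norm_num [Int.isUnit_iff] at this
  have ha1 : ¬ (2:ℤ) ∣ a₁ := fun h2 => by
    have h3 : (2:ℤ) ∣ a₁ ^ 2 := dvd_pow h2 two_ne_zero
    have h4 : (2:ℤ) ∣ 7 * b ^ 2 := by rw [hKdef] at hKeven; omega
    exact hb2 (Int.prime_two.dvd_of_dvd_pow (n := 2) (by omega))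
  -- (E5) `K = 2^e · g`, `g` odd and positive
  have hKpos : 0 < K := by rw [hKdef]; positivity
  obtain ⟨e, g, hKeg, hg2, -⟩ := two_adic_decomp hKpos.ne'
  have hg0 : 0 < g := by
    rw [hKeg] at hKpos
    nlinarith [pow_pos (show (0:ℤ) < 2 from two_pos) e]
  have hpg : ¬ (2:ℤ) ∣ p * g ^ 2 := fun h2 =>
    (Int.prime_two.dvd_mul.mp h2).elim hp2 (fun h3 => hg2 (Int.prime_two.dvd_of_dvd_pow h3))
  -- (E6) `L ≤ 2e + 2`, so `e ≥ 11`; write `e = e' + 4`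
  have hLe : L ≤ 2 * e + 2 := by
    have hdvd : (2:ℤ) ^ L ∣ 2 ^ (2 * e + 2) * (p * g ^ 2) :=
      ⟨W, by rw [hKeg] at hW; linear_combination -hW⟩
    exact le_of_pow_dvd_pow_mul_odd hpg hdvd
  obtain ⟨e', rfl⟩ : ∃ e', e = e' + 4 := ⟨e - 4, by omega⟩
  -- (E7)–(E9) `W = K Q' + 176 R = 16 W'` with `W'` odd, hence `L + 4 = 2e' + 10`, `W' = p g²`
  set Q' := 3 * a₁ ^ 2 - 4 * a₁ * b + 73 * b ^ 2 with hQ'def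
  set R := b ^ 3 * (a₁ - 2 * b) with hRdef
  have hWKQR : W = K * Q' + 176 * R := by simp only [hWdef, hKdef, hQ'def, hRdef]; ring
  set W' := 2 ^ e' * g * Q' + 11 * R with hW'def
  have hW16 : W = 16 * W' := by rw [hWKQR, hW'def, hKeg]; ring
  have hRodd : ¬ (2:ℤ) ∣ R := by
    rw [hRdef]; intro h2
    rcases Int.prime_two.dvd_mul.mp h2 with h3 | h3
    · exact hb2 (Int.prime_two.dvd_of_dvd_pow h3)
    · omega
  have he'7 : 7 ≤ e' := by omega
  have hW'odd : ¬ (2:ℤ) ∣ W' := by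
    rw [hW'def]; intro h2
    have h3 : (2:ℤ) ∣ 2 ^ e' * g * Q' :=
      dvd_mul_of_dvd_left (dvd_mul_of_dvd_left (dvd_pow_self 2 (by omega)) g) Q'
    have h4 : (2:ℤ) ∣ 11 * R := by omega
    exact hRodd (by omega)
  have hcmp : 2 ^ (L + 4) * W' = 2 ^ (2 * e' + 10) * (p * g ^ 2) := by
    have h1 := hW
    rw [hW16, hKeg] at h1
    linear_combination h1
  have hLeq : L + 4 = 2 * e' + 10 := by
    have h1 := le_of_pow_dvd_pow_mul_odd hpg ⟨W', hcmp.symm⟩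
    have h2 := le_of_pow_dvd_pow_mul_odd hW'odd ⟨p * g ^ 2, hcmp⟩
    omega
  have hW'eq : W' = p * g ^ 2 := by
    rw [hLeq] at hcmp
    exact mul_left_cancel₀ (pow_ne_zero _ two_ne_zero) hcmp
  have hW'eq' : 2 ^ e' * g * Q' + 11 * R = p * g ^ 2 := by rw [← hW'eq]
  -- (E10) `32 ∣ 11 R − g²`
  have he'9 : 9 ≤ e' := by omega
  have h32 : (32:ℤ) ∣ 11 * R - g ^ 2 := by
    have h2e : (32:ℤ) ∣ 2 ^ e' := by
      obtain ⟨f, hf⟩ : ∃ f, e' = f + 5 := ⟨e' - 5, by omega⟩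
      rw [hf, pow_add, show (2:ℤ) ^ 5 = 32 by norm_num]
      exact dvd_mul_left _ _
    have e1 : 11 * R - g ^ 2 = (p - 1) * g ^ 2 - 2 ^ e' * (g * Q') := by
      linear_combination hW'eq'
    rw [e1]
    exact dvd_sub (dvd_mul_of_dvd_left hp _) (dvd_mul_of_dvd_left h2e _)
  -- parity of `e'` from `4 ∣ L`:  `e' + 2 = 2k + 5`
  obtain ⟨k, hk⟩ : ∃ k : ℕ, e' + 2 = 2 * k + 5 := ⟨(e' - 3) / 2, by omega⟩
  -- (G) descent in `ℤ[ω]`: `a₁ = 2c + b`, `N(c + bω) = K/4 = 2^{2k+5} g`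
  obtain ⟨c, hc⟩ : ∃ c : ℤ, a₁ = 2 * c + b := ⟨(a₁ - b) / 2, by omega⟩
  have hnrm : nrm (c, b) = 2 ^ (2 * k + 5) * g := by
    rw [← hk, show nrm (c, b) = c ^ 2 + c * b + 2 * b ^ 2 from rfl]
    apply mul_left_cancel₀ (by norm_num : (4:ℤ) ≠ 0)
    rw [show (4:ℤ) * (2 ^ (e' + 2) * g) = 2 ^ (e' + 4) * g by ring, ← hKeg, hKdef, hc]
    ring
  have hprim : ¬ ((2:ℤ) ∣ ((c, b) : ℤ × ℤ).1 ∧ (2:ℤ) ∣ ((c, b) : ℤ × ℤ).2) := fun h2 => hb2 h2.2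
  obtain ⟨η, hη, hbranch⟩ := descent (2 * k + 5) (c, b) g hprim hnrm
  -- (H) `g ∈ {1, 11}`
  have hcopK : IsCoprime K b := by
    have h1 : IsCoprime a₁ b := hab
    have h2 : IsCoprime (a₁ ^ 2 + b * (7 * b)) b := (h1.pow_left (m := 2)).add_mul_left_left (7 * b)
    rw [hKdef]; convert h2 using 2; ring
  have hgK : g ∣ K := ⟨2 ^ (e' + 4), by rw [hKeg]; ring⟩
  have hcopg : IsCoprime g b := hcopK.of_isCoprime_of_dvd_left hgK
  have hg11 : g ∣ 11 * (a₁ - 2 * b) := by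
    have h1 : g ∣ 11 * (a₁ - 2 * b) * b ^ 3 := by
      have e1 : 11 * (a₁ - 2 * b) * b ^ 3 = g * (p * g - 2 ^ e' * Q') := by
        rw [hRdef] at hW'eq'; linear_combination hW'eq'
      rw [e1]; exact dvd_mul_right g _
    exact (hcopg.pow_right (n := 3)).dvd_of_dvd_mul_right h1
  have hg121 : g ∣ 121 := by
    have h121 : g ∣ 121 * b ^ 2 := by
      have e1 : 121 * b ^ 2 = 11 * K - (a₁ + 2 * b) * (11 * (a₁ - 2 * b)) := by rw [hKdef]; ring
      rw [e1]; exact dvd_sub (dvd_mul_of_dvd_right hgK 11) (dvd_mul_of_dvd_right hg11 _)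
    exact (hcopg.pow_right (n := 2)).dvd_of_dvd_mul_right h121
  have hg_cases : g = 1 ∨ g = 11 ∨ g = 121 := by
    have h1 : g.natAbs ∣ 11 ^ 2 := by
      have := Int.natAbs_dvd_natAbs.mpr hg121; simpa using this
    obtain ⟨i, hi, hgi⟩ := (Nat.dvd_prime_pow (by norm_num : Nat.Prime 11)).mp h1
    have hg' : g = (g.natAbs : ℤ) := (Int.natAbs_of_nonneg hg0.le).symm
    interval_cases i <;> simp at hgi <;> omega
  have hg_ne : g ≠ 121 := by
    intro hg
    subst hg
    have h11 : (11:ℤ) ∣ a₁ - 2 * b := by obtain ⟨q, hq⟩ := hg11; exact ⟨q, by linarith⟩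
    have h11Q : (11:ℤ) ∣ Q' := by
      have e1 : Q' = (a₁ - 2 * b) * (3 * a₁ + 2 * b) + 11 * (7 * b ^ 2) := by rw [hQ'def]; ring
      rw [e1]; exact dvd_add (dvd_mul_of_dvd_left h11 _) (dvd_mul_right 11 _)
    have h121R : (121:ℤ) ∣ R := by
      have hR : R = 11 * (121 * p - 2 ^ e' * Q') := by
        apply mul_left_cancel₀ (by norm_num : (11:ℤ) ≠ 0)
        linear_combination hW'eq'
      rw [hR]; obtain ⟨q, hq⟩ := h11Q; rw [hq]; exact ⟨11 * p - 2 ^ e' * q, by ring⟩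
    have h121a : (121:ℤ) ∣ a₁ - 2 * b := by
      have h1 : (121:ℤ) ∣ (a₁ - 2 * b) * b ^ 3 := by rw [hRdef, mul_comm] at h121R; exact h121R
      exact (hcopg.pow_right (n := 3)).dvd_of_dvd_mul_right h1
    have h121K : (121:ℤ) ∣ K := hgK
    have h11b2 : (11:ℤ) ∣ b ^ 2 := by
      have e1 : 11 * b ^ 2 = K - (a₁ - 2 * b) * (a₁ + 2 * b) := by rw [hKdef]; ring
      have h1 : (121:ℤ) ∣ 11 * b ^ 2 := by rw [e1]; exact dvd_sub h121K (dvd_mul_of_dvd_left h121a _)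
      obtain ⟨q, hq⟩ := h1; exact ⟨q, by linarith⟩
    have h11b : (11:ℤ) ∣ b := (Int.prime_iff_natAbs_prime.mpr (by norm_num)).dvd_of_dvd_pow h11b2
    have := hcopg.isUnit_of_dvd' ⟨11, by norm_num⟩ h11b
    norm_num [Int.isUnit_iff] at this
  have hg1or11 : g = 1 ∨ g = 11 := by omega
  -- (J) the final incongruence mod 32
  have h32' : (32:ℤ) ∣ 11 * b ^ 3 * (2 * c - b) - g ^ 2 := by
    have e1 : 11 * b ^ 3 * (2 * c - b) - g ^ 2 = 11 * R - g ^ 2 := by rw [hRdef, hc]; ring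
    rwa [e1]
  rcases hbranch with hω | hωb
  · -- `ω`-branch: `32 ∣ c + 6b` and `b ≡ b₅ (mod 8)`
    have hinv := lineW_inv η (2 * k)
    have hsnd := lineW_snd η k
    rw [← hω] at hinv hsnd
    change (32:ℤ) ∣ c + 6 * b at hinv
    change (8:ℤ) ∣ b - (mulW^[5] η).2 at hsnd
    have h143 : (32:ℤ) ∣ 143 * b ^ 4 + g ^ 2 := by
      have e1 : 143 * b ^ 4 + g ^ 2 = 22 * b ^ 3 * (c + 6 * b) - (11 * b ^ 3 * (2 * c - b) - g ^ 2) := by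
        ring
      rw [e1]; exact dvd_sub (dvd_mul_of_dvd_right hinv _) h32'
    rcases hg1or11 with rfl | rfl
    · -- `g = 1`: `η = ±1`, so `b ≡ ∓1 (mod 8)`
      obtain ⟨η₁, η₂⟩ := η
      change η₁ ^ 2 + η₁ * η₂ + 2 * η₂ ^ 2 = 1 at hη
      obtain ⟨rfl, h1 | h1⟩ := nrm_eq_one hη <;> subst h1
      · rw [mulW_iter5] at hsnd
        change (8:ℤ) ∣ b - (-1 + 5 * 0) at hsnd
        obtain ⟨j, hj⟩ : ∃ j, b = 8 * j - 1 := by obtain ⟨s, hs⟩ := hsnd; exact ⟨s, by omega⟩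
        subst hj
        exact res_a j h143
      · rw [mulW_iter5] at hsnd
        change (8:ℤ) ∣ b - (-(-1) + 5 * 0) at hsnd
        obtain ⟨j, hj⟩ : ∃ j, b = 8 * j + 1 := by obtain ⟨s, hs⟩ := hsnd; exact ⟨s, by omega⟩
        subst hj
        exact res_b j h143
    · -- `g = 11`, `b` odd
      obtain ⟨j, hj⟩ : ∃ j, b = 2 * j + 1 := ⟨(b - 1) / 2, by omega⟩
      subst hj
      exact res_c j h143
  · -- `ω̄`-branch: `32 ∣ c − 5b`
    have hinv := lineWb_inv η (2 * k)
    rw [← hωb] at hinv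
    change (32:ℤ) ∣ c - 5 * b at hinv
    have h99 : (32:ℤ) ∣ 99 * b ^ 4 - g ^ 2 := by
      have e1 : 99 * b ^ 4 - g ^ 2 = (11 * b ^ 3 * (2 * c - b) - g ^ 2) - 22 * b ^ 3 * (c - 5 * b) := by
        ring
      rw [e1]; exact dvd_sub h32' (dvd_mul_of_dvd_right hinv _)
    obtain ⟨j, hj⟩ : ∃ j, b = 2 * j + 1 := ⟨(b - 1) / 2, by omega⟩
    subst hj
    rcases hg1or11 with rfl | rfl
    · exact res_d j h99
    · exact res_e j h99


/-! ### §4  the level set of `M30` is EMPTY at every depth `N ≥ 4` -/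

/-- `p_N ≡ 1 (mod 32)` for `N ≥ 4` (`p_N = 2^{(N-1)·(N-1)!}·p_{N-1} + 1`). -/
theorem psNumer_two_mod32 {N : ℕ} (hN : 4 ≤ N) : (32:ℤ) ∣ (psNumer 2 N : ℤ) - 1 := by
  obtain ⟨M, rfl⟩ : ∃ M, N = M + 1 := ⟨N - 1, by omega⟩
  have hM : 3 ≤ M := by omega
  have hfac : 6 ≤ M ! := by
    calc (6:ℕ) = 3 ! := by decide
      _ ≤ M ! := Nat.factorial_le hM
  have h5 : 5 ≤ M * M ! := by nlinarith
  obtain ⟨f, hf⟩ : ∃ f, M * M ! = f + 5 := ⟨M * (M !) - 5, by omega⟩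
  rw [psNumer_succ' M, hf]
  push_cast
  rw [pow_add, show (2:ℤ) ^ 5 = 32 by norm_num]
  exact ⟨2 ^ f * psNumer 2 M, by ring⟩

/-- **Theorem (the EXACT level set of `M30`; elementary and effective).**  At every depth `N ≥ 4` the
truncation level `x = S_N(2) = p_N / 2^{N!}` carries NO rational point of `M30` whatsoever. -/
theorem m30_no_level_point {N : ℕ} (hN : 4 ≤ N) (r : ℚ) :
    bev (boxP m30Box) (partialSum 2 N) r ≠ 0 := by
  intro h
  rw [partialSum_two_eq_ratCast N] at h
  set x : ℚ := (psNumer 2 N : ℚ) / 2 ^ N ! with hx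
  have hp32 := psNumer_two_mod32 hN
  have hL24 : 24 ≤ N ! := by
    calc (24:ℕ) = 4 ! := by decide
      _ ≤ N ! := Nat.factorial_le hN
  have hL4 : 4 ∣ N ! := Nat.dvd_factorial (by norm_num) hN
  have h2pos : (0:ℚ) < 2 ^ N ! := by positivity
  -- the curve equation over `ℚ`
  have hQ : 11 * x ^ 2 + (4 * r ^ 2 + r - 27) * x + (r ^ 4 - r ^ 3 - 6 * r ^ 2 + 2 * r + 15) = 0 := by
    have h' := h
    rw [bev_m30] at h'
    have h'' : r ^ 4 - r ^ 3 - 6 * r ^ 2 + 2 * r + 15 + x * (4 * r ^ 2 + r - 27) + 11 * x ^ 2 = 0 := by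
      exact_mod_cast h'
    linear_combination h''
  -- `x ∉ {1, 3/4}` by the parity of `p_N`, so `r ≠ 1, 3/2`
  have hx1 : x ≠ 1 := by
    intro h1
    rw [hx, div_eq_iff h2pos.ne', one_mul] at h1
    have e2 : (psNumer 2 N : ℤ) = 2 ^ N ! := by exact_mod_cast h1
    have : (2:ℤ) ∣ (psNumer 2 N : ℤ) := by
      rw [e2]; exact dvd_pow_self 2 (Nat.factorial_pos N).ne'
    omega
  have hx34 : x ≠ 3 / 4 := by
    intro h34
    rw [hx, div_eq_iff h2pos.ne'] at h34
    have e2 : (4 * psNumer 2 N : ℤ) = 3 * 2 ^ N ! := by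
      have e1 : (4 * psNumer 2 N : ℚ) = 3 * 2 ^ N ! := by linarith
      exact_mod_cast e1
    obtain ⟨M, hM⟩ : ∃ M, N ! = M + 3 := ⟨(N !) - 3, by omega⟩
    rw [hM, pow_add] at e2
    have : (2:ℤ) ∣ (psNumer 2 N : ℤ) := ⟨3 * 2 ^ M, by linarith⟩
    omega
  have hr1 : r ≠ 1 := by
    rintro rfl
    have h0 : (x - 1) ^ 2 = 0 := by linear_combination hQ / 11
    exact hx1 (sub_eq_zero.mp (pow_eq_zero_iff two_ne_zero |>.mp h0))
  have hr2 : r ≠ 3 / 2 := by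
    rintro rfl
    have h0 : (x - 3 / 4) ^ 2 = 0 := by linear_combination hQ / 11
    exact hx34 (sub_eq_zero.mp (pow_eq_zero_iff two_ne_zero |>.mp h0))
  -- the tree's parametrisation (census certificate `RootDecomp1KGenusZeroNormShape.m30_normShape`)
  obtain ⟨t, ht⟩ := m30_normShape x r hQ hr1 hr2
  have ht' : 3 * t ^ 4 + 4 * t ^ 3 + 94 * t ^ 2 - 148 * t + 159 = 4 * x * (t ^ 2 + 7) ^ 2 := by
    simp only [eval_mul, eval_C, eval_add, eval_sub, eval_pow, eval_X, eval_ofNat] at ht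
    linear_combination 4 * ht
  -- `t = A/B` in lowest terms; clear denominators and apply the core to `(a₁, b) = (A, −B)`
  set A : ℤ := t.num with hA
  set B : ℤ := (t.den : ℤ) with hB
  have hB0 : B ≠ 0 := by rw [hB]; exact_mod_cast t.den_nz
  have hAB : IsCoprime A B := by rw [hA, hB]; exact Int.isCoprime_iff_gcd_eq_one.mpr t.reduced
  have hBq : (B : ℚ) ≠ 0 := by exact_mod_cast hB0
  have htq : t = (A : ℚ) / (B : ℚ) := by
    rw [hA, hB, eq_div_iff hBq]; exact_mod_cast (Rat.mul_den_eq_num t)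
  have hU : (3 * (A : ℚ) ^ 4 - 4 * (A : ℚ) ^ 3 * (-(B : ℚ)) + 94 * (A : ℚ) ^ 2 * (-(B : ℚ)) ^ 2
      + 148 * (A : ℚ) * (-(B : ℚ)) ^ 3 + 159 * (-(B : ℚ)) ^ 4)
      = (B : ℚ) ^ 4 * (3 * t ^ 4 + 4 * t ^ 3 + 94 * t ^ 2 - 148 * t + 159) := by
    rw [htq]; field_simp; ring
  have hK : (A : ℚ) ^ 2 + 7 * (-(B : ℚ)) ^ 2 = (B : ℚ) ^ 2 * (t ^ 2 + 7) := by
    rw [htq]; field_simp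
  have key : (((2 : ℤ) ^ N ! * (3 * A ^ 4 - 4 * A ^ 3 * (-B) + 94 * A ^ 2 * (-B) ^ 2 + 148 * A * (-B) ^ 3
      + 159 * (-B) ^ 4) : ℤ) : ℚ) = ((4 * (psNumer 2 N : ℤ) * (A ^ 2 + 7 * (-B) ^ 2) ^ 2 : ℤ) : ℚ) := by
    push_cast
    rw [hU, hK, ht', hx]
    field_simp
  exact m30_core (N !) hL24 hL4 _ hp32 A (-B) (neg_ne_zero.mpr hB0) hAB.neg_right (by exact_mod_cast key)

/-- Corollary: every level set of `M30` lies in `{0, 1, 2, 3}` — an EFFECTIVE form of the tree's `levelFinite_m30`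
(`N = 1`, `x = s₁ = 1`, `r = 1` is a level point, so the bound cannot drop below `2`). -/
theorem levelSet_m30_subset (C : ℝ) : LevelSet (boxP m30Box) C ⊆ Set.Iio 4 := by
  rintro N ⟨r, -, hr, -⟩
  by_contra hN
  exact m30_no_level_point (by simpa using hN) r hr

/- PORT NOTE (census-1 g27): the lens's `theorem levelFinite_m30_elementary : LevelFinite (boxP m30Box)` restates the
landed census certificate `RootDecomp1KGenusZeroNormShape.levelFinite_m30` (gate dedup.landed at the dry-run of this part) — the
decision OF RECORD; the lens's elementary (Ridout-free) ROUTE to it is kept here as a checked `example` instead of a second name.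
Original docstring: the elementary (Ridout-free) route to `LevelFinite M30` (the tree's `levelFinite_m30` is the one of record). -/
example : LevelFinite (boxP m30Box) :=
  fun C => (Set.finite_Iio 4).subset (levelSet_m30_subset C)

end M30Exact

end Summit.Schanuel.Schanuel.Theorems.RootDecomp1KM30LevelSet
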